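import Mathlib.NumberTheory.LSeries.Dirichlet
import Mathlib.Analysis.Real.Pi.Bounds
import Literature.NumberTheory.LFunctions.XiIntegralBridge
import Literature.NumberTheory.LFunctions.ZetaArgVariation
import Literature.Analysis.SpecialFunctions.GammaStirlingUniform
import HarnessLib

/-!
# The integral of Riemann's `ξ`-function (Lagarias–Montague 2011) — Lemma 3.3 (2) proved

Literature/NumberTheory/LFunctions; companion of `XiIntegral.lean`, which vendors the named facts of
J. C. Lagarias, D. Montague, *The integral of the Riemann ξ-function*, Comment. Math. Univ. St. Pauli
**60** (2011) 143–169 (arXiv:1106.4348), and of `XiIntegralProofs.lean` (Lemma 3.3 (1), §5). This file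
DISCHARGES

* `LagariasMontague2011_lem_3_3_ii_holds : LagariasMontague2011_lem_3_3_ii` — Lemma 3.3 (2) of the
  paper: for `σ ≥ 2` and all real `t`,
  `F(σ,t)(1 − C₂(1/|σ+it| + 2^{−σ})) ≤ |ξ(σ+it)| ≤ F(σ,t)(1 + C₃(1/|σ+it| + 2^{−σ}))` with the
  comparison function `F = lagariasMontagueF` of [LM, eq. (3.3)]; we obtain it with `C₂ = 8`,
  `C₃ = 8e⁶`.

The proof is the printed one ([LM, p. 151]): `ξ(s) = ½ s(s−1) π^{−s/2} Γ(s/2) ζ(s)`,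
`|s(s−1)| = |s|²(1 + O(1/|s|))`, `|ζ(s)| = 1 + O(2^{−σ})`, `|π^{−s/2}| = π^{−σ/2}` and Stirling's
formula `log |Γ(s/2)| = Re((s/2 − ½) log(s/2) − s/2) + ½ log 2π + O(1/|s|)`; the only input not in
Mathlib is the last one, which is the tree's uniform half-plane Stirling bound
`Literature.Analysis.SpecialFunctions.GammaStirling.abs_log_norm_Gamma_sub_le`
(`GammaStirlingUniform.lean`; packaged here as `abs_log_norm_Gamma_sub_stirling_le_quarter`,
error `≤ 1/(4|z|)` for `|z| ≥ 1`). Everything is done at the level of logarithms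
(`log |ξ(s)| − log F(σ,t) = (log|s−1| − log|s|) + (Stirling error) + log|ζ(s)|`, the main terms
cancelling identically) and exponentiated once at the end.

Intermediate results, all proved here: `abs_log_norm_riemannZeta_le` (`|log|ζ(s)|| ≤ 8·2^{−σ}` for
`σ ≥ 2`, from the tree's `norm_riemannZeta_sub_one_le_of_two_le_re`, `ZetaArgVariation.lean`),
`norm_riemannXi_eq_of_one_lt_re` (the factorisation of `|ξ|`), `log_lagariasMontagueF`,
`arg_ofReal_add_mul_I`. By `XiIntegralBridge.lean` (`LagariasMontague2011_lemma33_2_iff`, `Iff.rfl`) the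
main theorem also proves the duplicate vendored statement `LagariasMontague2011_lemma33_2` of
`XiPrimitive.lean` (`LagariasMontague2011_lemma33_2_holds`, last theorem of this file).
-/

noncomputable section

open Complex Real MeasureTheory
open _root_.Filter
open scoped _root_.Topology

namespace Literature.NumberTheory.LFunctions

/-! ## `log |ζ(s)| = O(2^{−σ})` for `σ ≥ 2` -/

/-- For `σ = Re s ≥ 2`: `|log ‖ζ(s)‖| ≤ 8 · 2^{−σ}` (from `‖ζ(s) − 1‖ ≤ 2^{2−σ}(π²/6 − 1)`, the tree's
`norm_riemannZeta_sub_one_le_of_two_le_re`; `4(π²/6 − 1) < 2.62` and `log x ∈ [1 − 1/x, x − 1]`);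
[LM] p. 151: "`|ζ(s)| = 1 + O(2^{−σ})`". [folklore] -/
theorem abs_log_norm_riemannZeta_le {s : ℂ} (hs : 2 ≤ s.re) :
    |Real.log ‖riemannZeta s‖| ≤ 8 * (2 : ℝ) ^ (-s.re) := by
  set δ : ℝ := 4 * (π ^ 2 / 6 - 1) * (2 : ℝ) ^ (-s.re) with hδdef
  have hδ : ‖riemannZeta s - 1‖ ≤ δ := by
    have h := norm_riemannZeta_sub_one_le_of_two_le_re hs
    have h42 : (2 : ℝ) ^ (2 - s.re) = 4 * (2 : ℝ) ^ (-s.re) := by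
      rw [sub_eq_add_neg, Real.rpow_add two_pos, Real.rpow_two]
      norm_num
    rw [h42] at h
    rw [hδdef]
    linarith
  have hc : 4 * (π ^ 2 / 6 - 1) ≤ 131 / 50 := by
    have := Real.pi_lt_d2
    nlinarith [Real.pi_pos]
  have hc0 : 0 ≤ 4 * (π ^ 2 / 6 - 1) := by
    have := Real.pi_gt_three
    nlinarith
  have h2σ : (2 : ℝ) ^ (-s.re) ≤ 1 / 4 := by
    have : (2 : ℝ) ^ (-s.re) ≤ (2 : ℝ) ^ (-2 : ℝ) :=
      Real.rpow_le_rpow_of_exponent_le (by norm_num) (by linarith)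
    refine this.trans (le_of_eq ?_)
    rw [Real.rpow_neg (by norm_num), Real.rpow_two]
    norm_num
  have h2σ0 : 0 < (2 : ℝ) ^ (-s.re) := by positivity
  have hδ0 : 0 ≤ δ := by positivity
  have hδ1 : δ ≤ 131 / 200 := by
    have : δ ≤ 131 / 50 * (1 / 4) := by
      rw [hδdef]
      exact mul_le_mul hc h2σ h2σ0.le (by norm_num)
    linarith
  -- `‖ζ‖ ∈ [1 − δ, 1 + δ]`
  have hup : ‖riemannZeta s‖ ≤ 1 + δ := by
    calc ‖riemannZeta s‖ = ‖1 + (riemannZeta s - 1)‖ := by ring_nf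
      _ ≤ ‖(1 : ℂ)‖ + ‖riemannZeta s - 1‖ := norm_add_le _ _
      _ ≤ 1 + δ := by rw [norm_one]; gcongr
  have hlow : 1 - δ ≤ ‖riemannZeta s‖ := by
    have h1 : ‖(1 : ℂ)‖ - ‖1 - riemannZeta s‖ ≤ ‖riemannZeta s‖ := by
      have := norm_sub_norm_le (1 : ℂ) (1 - riemannZeta s)
      simp only [sub_sub_cancel] at this
      linarith
    rw [norm_one, norm_sub_rev] at h1
    linarith
  have hpos : 0 < ‖riemannZeta s‖ := by linarith
  rw [abs_le]
  constructor
  · -- lower bound: `log x ≥ 1 − 1/x ≥ −δ/(1−δ) ≥ −3δ`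
    have h1 := Real.one_sub_inv_le_log_of_pos hpos
    have h2 : (‖riemannZeta s‖)⁻¹ ≤ (1 - δ)⁻¹ := by
      gcongr
      linarith
    have h3 : (1 - δ)⁻¹ ≤ 1 + 3 * δ := by
      rw [inv_eq_one_div, div_le_iff₀ (by linarith)]
      nlinarith
    nlinarith
  · have h1 := Real.log_le_sub_one_of_pos hpos
    nlinarith

/-! ## Stirling for `log |Γ(z)|`, packaged -/

/-- Stirling's formula for the modulus of `Γ`, uniform in the right half-plane (the tree's
`Literature.Analysis.SpecialFunctions.GammaStirling.abs_log_norm_Gamma_sub_le`, whose error is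
`(1/12)(1/|z|² + π/(2|z|))`), packaged for `|z| ≥ 1` with the round constant `1/4`:
`|log |Γ(z)| − ((Re z − ½) log |z| − Im z · Arg z − Re z + ½ log 2π)| ≤ 1/(4|z|)`
(`(1 + π/2)/12 ≤ 1/4` as `π ≤ 4`). [cite: WhittakerWatson1927, §12.33] -/
theorem abs_log_norm_Gamma_sub_stirling_le_quarter {z : ℂ} (hz : 0 < z.re) (h1 : 1 ≤ ‖z‖) :
    |Real.log ‖Complex.Gamma z‖ -
        ((z.re - 1 / 2) * Real.log ‖z‖ - z.im * arg z - z.re + Real.log (2 * π) / 2)| ≤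
      1 / (4 * ‖z‖) := by
  refine (Literature.Analysis.SpecialFunctions.GammaStirling.abs_log_norm_Gamma_sub_le hz).trans ?_
  have hr : 0 < ‖z‖ := by positivity
  have hπ := Real.pi_le_four
  have h2 : 1 / ‖z‖ ^ 2 ≤ 1 / ‖z‖ := by
    rw [div_le_div_iff₀ (by positivity) hr]
    nlinarith
  have h3 : π / (2 * ‖z‖) ≤ 2 / ‖z‖ := by
    rw [div_le_div_iff₀ (by positivity) hr]
    nlinarith
  have h4 : (1 / 12 : ℝ) * (1 / ‖z‖ ^ 2 + π / (2 * ‖z‖)) ≤ (1 / 12) * (1 / ‖z‖ + 2 / ‖z‖) := by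
    gcongr
  refine h4.trans (le_of_eq ?_)
  field_simp
  ring

/-! ## The modulus of `ξ(s)` for `Re s > 1` -/

/-- `Arg (σ + it) = arctan (t/σ)` for `σ > 0`. [folklore] -/
theorem arg_ofReal_add_mul_I {σ : ℝ} (hσ : 0 < σ) (t : ℝ) :
    arg ((σ : ℂ) + t * I) = Real.arctan (t / σ) := by
  have hre : ((σ : ℂ) + t * I).re = σ := by simp
  have him : ((σ : ℂ) + t * I).im = t := by simp
  have h1 : |arg ((σ : ℂ) + t * I)| < π / 2 :=
    Complex.abs_arg_lt_pi_div_two_iff.2 (Or.inl (by rw [hre]; exact hσ))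
  rw [← Real.arctan_tan (abs_lt.1 h1).1 (abs_lt.1 h1).2, Complex.tan_arg, hre, him]

/-- `|ξ(s)| = ½ |s| |s−1| π^{−σ/2} |Γ(s/2)| |ζ(s)|` for `Re s > 1` (from
`ξ(s) = ½ s(s−1) Λ(s)`, `Λ = Γ_ℝ · ζ`, `Γ_ℝ(s) = π^{−s/2} Γ(s/2)`). [folklore] -/
theorem norm_riemannXi_eq_of_one_lt_re {s : ℂ} (hs : 1 < s.re) :
    ‖riemannXi s‖ = ‖s‖ * ‖s - 1‖ / 2 * π ^ (-s.re / 2) * ‖Complex.Gamma (s / 2)‖ *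
      ‖riemannZeta s‖ := by
  have hs0 : s ≠ 0 := fun h ↦ by rw [h, Complex.zero_re] at hs; linarith
  have hs1 : s ≠ 1 := fun h ↦ by rw [h, Complex.one_re] at hs; linarith
  have hG : Gammaℝ s ≠ 0 := Gammaℝ_ne_zero_of_re_pos (by linarith)
  have hΛ : completedRiemannZeta s = Gammaℝ s * riemannZeta s := by
    rw [riemannZeta_def_of_ne_zero hs0]
    field_simp
  rw [riemannXi_eq_mul_completedRiemannZeta hs0 hs1, hΛ, Gammaℝ_def, norm_mul, norm_mul, norm_mul,
    norm_div, norm_mul, Complex.norm_cpow_eq_rpow_re_of_pos Real.pi_pos]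
  simp only [Complex.norm_ofNat, Complex.neg_re, Complex.div_ofNat_re, neg_div]
  ring

/-- `F(σ,t) > 0`. [folklore] -/
theorem lagariasMontagueF_pos {σ : ℝ} (hσ : 0 < σ) (t : ℝ) : 0 < lagariasMontagueF σ t := by
  unfold lagariasMontagueF
  have : 0 < σ ^ 2 + t ^ 2 := by positivity
  positivity

/-- `log F(σ,t) = ½ log π − (σ/2)(log 2 + log π + 1) + ((σ+3)/2) log |σ+it| − (t/2) arctan(t/σ)`
for `σ > 0`. [folklore] -/
theorem log_lagariasMontagueF {σ : ℝ} (hσ : 0 < σ) (t : ℝ) :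
    Real.log (lagariasMontagueF σ t) = Real.log π / 2 - σ / 2 * (Real.log 2 + Real.log π + 1) +
      (σ + 3) / 2 * Real.log ‖(σ : ℂ) + t * I‖ - t / 2 * Real.arctan (t / σ) := by
  have hst : 0 < σ ^ 2 + t ^ 2 := by positivity
  have hnorm : Real.log ‖(σ : ℂ) + t * I‖ = Real.log (σ ^ 2 + t ^ 2) / 2 := by
    have h1 : ‖(σ : ℂ) + t * I‖ ^ 2 = σ ^ 2 + t ^ 2 := by
      rw [Complex.sq_norm, Complex.normSq_add_mul_I]
    have h2 : Real.log (‖(σ : ℂ) + t * I‖ ^ 2) = 2 * Real.log ‖(σ : ℂ) + t * I‖ := by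
      rw [Real.log_pow]; norm_num
    rw [← h1, h2]
    ring
  unfold lagariasMontagueF
  rw [Real.log_mul (by positivity) (by positivity), Real.log_mul (by positivity) (by positivity),
    Real.log_mul (by positivity) (by positivity), Real.log_sqrt Real.pi_pos.le,
    Real.log_rpow (by positivity), Real.log_rpow hst, Real.log_exp,
    Real.log_mul (by positivity) (by positivity), Real.log_mul (by positivity) (by positivity),
    Real.log_exp, hnorm]
  ring

/-- `|log |s−1| − log |s|| ≤ 2/|s|` for `|s| ≥ 2`. [folklore] -/
theorem abs_log_norm_sub_one_sub_log_norm_le {s : ℂ} (hs : 2 ≤ ‖s‖) :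
    |Real.log ‖s - 1‖ - Real.log ‖s‖| ≤ 2 / ‖s‖ := by
  have hs0 : 0 < ‖s‖ := by linarith
  have hup : ‖s - 1‖ ≤ ‖s‖ + 1 := by
    calc ‖s - 1‖ ≤ ‖s‖ + ‖(1 : ℂ)‖ := norm_sub_le _ _
      _ = ‖s‖ + 1 := by rw [norm_one]
  have hlow : ‖s‖ - 1 ≤ ‖s - 1‖ := by
    have := norm_sub_norm_le s 1
    rw [norm_one] at this
    linarith
  have hpos : 0 < ‖s - 1‖ := by linarith
  have hq : Real.log ‖s - 1‖ - Real.log ‖s‖ = Real.log (‖s - 1‖ / ‖s‖) :=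
    (Real.log_div hpos.ne' hs0.ne').symm
  have hqpos : 0 < ‖s - 1‖ / ‖s‖ := by positivity
  rw [hq, abs_le]
  constructor
  · have h1 := Real.one_sub_inv_le_log_of_pos hqpos
    rw [inv_div] at h1
    -- `1 − |s|/|s−1| ≥ −2/|s|` since `|s−1| ≥ |s| − 1 ≥ |s|/2`
    have h2 : ‖s‖ / ‖s - 1‖ ≤ 1 + 2 / ‖s‖ := by
      rw [div_le_iff₀ hpos]
      have h3 : (1 + 2 / ‖s‖) * ‖s - 1‖ ≥ (1 + 2 / ‖s‖) * (‖s‖ - 1) := by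
        apply mul_le_mul_of_nonneg_left hlow (by positivity)
      have h4 : (1 + 2 / ‖s‖) * (‖s‖ - 1) = ‖s‖ + 1 - 2 / ‖s‖ := by
        field_simp
        ring
      have h5 : 2 / ‖s‖ ≤ 1 := by
        rw [div_le_one hs0]; exact hs
      linarith
    linarith
  · have h1 := Real.log_le_sub_one_of_pos hqpos
    have h2 : ‖s - 1‖ / ‖s‖ ≤ 1 + 1 / ‖s‖ := by
      rw [div_le_iff₀ hs0]
      have : (1 + 1 / ‖s‖) * ‖s‖ = ‖s‖ + 1 := by field_simp
      linarith
    have h3 : 1 / ‖s‖ ≤ 2 / ‖s‖ := by gcongr; norm_num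
    linarith

/-! ## Lemma 3.3 (2) -/

/-- **Logarithmic form of [LM, Lemma 3.3 (2)]**: for `σ ≥ 2` and all real `t`,
`|log |ξ(σ+it)| − log F(σ,t)| ≤ 8 (1/|σ+it| + 2^{−σ})`. The main terms cancel identically:
`log|ξ| − log F = (log|s−1| − log|s|) + (log|Γ(s/2)| − Stirling main term) + log|ζ(s)|`, and the three
brackets are `≤ 2/|s|`, `≤ 1/(2|s|)`, `≤ 8·2^{−σ}` respectively.
[cite: LagariasMontague2011, Lemma 3.3 (2)] -/
theorem abs_log_norm_riemannXi_sub_log_lagariasMontagueF_le {σ : ℝ} (hσ : 2 ≤ σ) (t : ℝ) :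
    |Real.log ‖riemannXi (σ + t * I)‖ - Real.log (lagariasMontagueF σ t)| ≤
      8 * (1 / ‖(σ : ℂ) + t * I‖ + (2 : ℝ) ^ (-σ)) := by
  set s : ℂ := σ + t * I with hs_def
  have hre : s.re = σ := by simp [hs_def]
  have him : s.im = t := by simp [hs_def]
  have hσ0 : 0 < σ := by linarith
  have hs_re : 1 < s.re := by rw [hre]; linarith
  have hnorm_s : σ ≤ ‖s‖ := by
    have := Complex.abs_re_le_norm s
    rwa [hre, abs_of_pos hσ0] at this
  have hs2 : 2 ≤ ‖s‖ := hσ.trans hnorm_s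
  have hs0' : 0 < ‖s‖ := by linarith
  -- `z = s/2`
  set z : ℂ := s / 2 with hz_def
  have hzre : z.re = σ / 2 := by simp [hz_def, hre]
  have hzim : z.im = t / 2 := by simp [hz_def, him]
  have hznorm : ‖z‖ = ‖s‖ / 2 := by simp [hz_def]
  have hz0 : 0 < z.re := by rw [hzre]; linarith
  have hz1 : 1 ≤ ‖z‖ := by rw [hznorm]; linarith
  have harg : arg z = Real.arctan (t / σ) := by
    have e : z = s * ((1 / 2 : ℝ) : ℂ) := by
      rw [hz_def]
      push_cast
      ring
    rw [e, Complex.arg_mul_real (by norm_num), hs_def, arg_ofReal_add_mul_I hσ0]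
  -- Stirling for `log ‖Γ(s/2)‖`
  have hSt := abs_log_norm_Gamma_sub_stirling_le_quarter hz0 hz1
  rw [hzre, hzim, hznorm, harg, Real.log_div hs0'.ne' two_ne_zero,
    Real.log_mul two_ne_zero Real.pi_pos.ne'] at hSt
  -- the logarithm of the factorisation of `|ξ|`
  have hΓpos : 0 < ‖Complex.Gamma z‖ := norm_pos_iff.2 (Complex.Gamma_ne_zero_of_re_pos hz0)
  have hζpos : 0 < ‖riemannZeta s‖ := norm_pos_iff.2 (riemannZeta_ne_zero_of_one_lt_re hs_re)
  have hs1pos : 0 < ‖s - 1‖ := by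
    have := norm_sub_norm_le s 1
    rw [norm_one] at this
    linarith
  have hππ : 0 < π ^ (-σ / 2) := Real.rpow_pos_of_pos Real.pi_pos _
  have hlogxi : Real.log ‖riemannXi s‖ = Real.log ‖s‖ + Real.log ‖s - 1‖ - Real.log 2 -
      σ / 2 * Real.log π + Real.log ‖Complex.Gamma z‖ + Real.log ‖riemannZeta s‖ := by
    rw [norm_riemannXi_eq_of_one_lt_re hs_re, hre, Real.log_mul (by positivity) hζpos.ne',
      Real.log_mul (by positivity) hΓpos.ne', Real.log_mul (by positivity) hππ.ne',
      Real.log_div (by positivity) two_ne_zero, Real.log_mul hs0'.ne' hs1pos.ne',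
      Real.log_rpow Real.pi_pos]
    ring
  have hζ := abs_log_norm_riemannZeta_le (s := s) (by rw [hre]; exact hσ)
  rw [hre] at hζ
  have hsm1 := abs_log_norm_sub_one_sub_log_norm_le hs2
  have key : Real.log ‖riemannXi s‖ - Real.log (lagariasMontagueF σ t) =
      (Real.log ‖s - 1‖ - Real.log ‖s‖) +
      (Real.log ‖Complex.Gamma z‖ - ((σ / 2 - 1 / 2) * (Real.log ‖s‖ - Real.log 2) -
        t / 2 * Real.arctan (t / σ) - σ / 2 + (Real.log 2 + Real.log π) / 2)) +
      Real.log ‖riemannZeta s‖ := by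
    rw [hlogxi, log_lagariasMontagueF hσ0 t]
    ring
  rw [key]
  calc _ ≤ |Real.log ‖s - 1‖ - Real.log ‖s‖| +
        |Real.log ‖Complex.Gamma z‖ - ((σ / 2 - 1 / 2) * (Real.log ‖s‖ - Real.log 2) -
          t / 2 * Real.arctan (t / σ) - σ / 2 + (Real.log 2 + Real.log π) / 2)| +
        |Real.log ‖riemannZeta s‖| := abs_add_three _ _ _
    _ ≤ 2 / ‖s‖ + 1 / (4 * (‖s‖ / 2)) + 8 * (2 : ℝ) ^ (-σ) := add_le_add_three hsm1 hSt hζ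
    _ ≤ 8 * (1 / ‖s‖ + (2 : ℝ) ^ (-σ)) := by
        have h1 : 2 / ‖s‖ + 1 / (4 * (‖s‖ / 2)) = (5 / 2) * (1 / ‖s‖) := by
          field_simp
          ring
        rw [h1]
        have h2 : 0 ≤ 1 / ‖s‖ := by positivity
        nlinarith

/-- `e^y ≤ 1 + y e^y` for `y ≥ 0`… in the form used below: `exp Δ ≤ 1 + |Δ| exp |Δ|`. [folklore] -/
theorem exp_le_one_add_abs_mul_exp_abs (Δ : ℝ) : Real.exp Δ ≤ 1 + |Δ| * Real.exp |Δ| := by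
  have h1 : Real.exp Δ ≤ Real.exp |Δ| := Real.exp_le_exp.2 (le_abs_self Δ)
  have hpos := Real.exp_pos |Δ|
  have h2 : (1 - |Δ|) * Real.exp |Δ| ≤ 1 := by
    have h3 := Real.add_one_le_exp (-|Δ|)
    rw [Real.exp_neg] at h3
    have h4 := mul_le_mul_of_nonneg_right h3 hpos.le
    rwa [inv_mul_cancel₀ hpos.ne', show (-|Δ| + 1) = (1 - |Δ|) by ring] at h4
  nlinarith

/-- **Lagarias–Montague 2011, Lemma 3.3 (2)**, discharged: with `C₂ = 8`, `C₃ = 8e⁶`, for `σ ≥ 2` and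
all real `t`, `F(σ,t)(1 − C₂(1/|σ+it| + 2^{−σ})) ≤ |ξ(σ+it)| ≤ F(σ,t)(1 + C₃(1/|σ+it| + 2^{−σ}))`
(exponentiate `abs_log_norm_riemannXi_sub_log_lagariasMontagueF_le`, using
`1/|s| + 2^{−σ} ≤ ¾`). [cite: LagariasMontague2011, Lemma 3.3 (2)] -/
theorem LagariasMontague2011_lem_3_3_ii_holds : LagariasMontague2011_lem_3_3_ii := by
  refine ⟨8, 8 * Real.exp 6, by norm_num, by positivity, fun σ t hσ ↦ ?_⟩
  have hσ0 : 0 < σ := by linarith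
  set s : ℂ := σ + t * I with hs_def
  set ε : ℝ := 1 / ‖s‖ + (2 : ℝ) ^ (-σ) with hε_def
  set Δ : ℝ := Real.log ‖riemannXi s‖ - Real.log (lagariasMontagueF σ t) with hΔ_def
  have hΔ : |Δ| ≤ 8 * ε := abs_log_norm_riemannXi_sub_log_lagariasMontagueF_le hσ t
  have hF := lagariasMontagueF_pos hσ0 t
  have hre : s.re = σ := by simp [hs_def]
  have hs_re : 1 < s.re := by rw [hre]; linarith
  have hnorm_s : σ ≤ ‖s‖ := by
    have := Complex.abs_re_le_norm s
    rwa [hre, abs_of_pos hσ0] at this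
  have hs0' : 0 < ‖s‖ := by linarith
  -- `|ξ(s)| > 0`
  have hξpos : 0 < ‖riemannXi s‖ := by
    rw [norm_riemannXi_eq_of_one_lt_re hs_re]
    have h1 : 0 < ‖s - 1‖ := by
      have := norm_sub_norm_le s 1
      rw [norm_one] at this
      linarith
    have h2 : 0 < ‖Complex.Gamma (s / 2)‖ :=
      norm_pos_iff.2 (Complex.Gamma_ne_zero_of_re_pos (by rw [Complex.div_ofNat_re, hre]; linarith))
    have h3 : 0 < ‖riemannZeta s‖ := norm_pos_iff.2 (riemannZeta_ne_zero_of_one_lt_re hs_re)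
    have h4 : 0 < π ^ (-s.re / 2) := Real.rpow_pos_of_pos Real.pi_pos _
    positivity
  -- `ε ≤ 3/4`
  have hε0 : 0 ≤ ε := by positivity
  have hε1 : ε ≤ 3 / 4 := by
    have h1 : 1 / ‖s‖ ≤ 1 / 2 := by
      rw [div_le_div_iff₀ hs0' two_pos]
      linarith
    have h2 : (2 : ℝ) ^ (-σ) ≤ 1 / 4 := by
      have : (2 : ℝ) ^ (-σ) ≤ (2 : ℝ) ^ (-2 : ℝ) :=
        Real.rpow_le_rpow_of_exponent_le (by norm_num) (by linarith)
      refine this.trans (le_of_eq ?_)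
      rw [Real.rpow_neg (by norm_num), Real.rpow_two]
      norm_num
    linarith
  -- `|ξ| = F · e^Δ`
  have hexp : ‖riemannXi s‖ = lagariasMontagueF σ t * Real.exp Δ := by
    rw [hΔ_def, Real.exp_sub, Real.exp_log hξpos, Real.exp_log hF]
    field_simp
  rw [hexp]
  constructor
  · -- lower bound: `1 − 8ε ≤ 1 + Δ ≤ e^Δ`
    gcongr
    have h1 := Real.add_one_le_exp Δ
    have h2 := (abs_le.1 hΔ).1
    linarith
  · -- upper bound: `e^Δ ≤ 1 + |Δ| e^{|Δ|} ≤ 1 + 8ε e⁶`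
    gcongr
    have h1 := exp_le_one_add_abs_mul_exp_abs Δ
    have h6 : |Δ| ≤ 6 := by linarith
    have h2 : |Δ| * Real.exp |Δ| ≤ (8 * ε) * Real.exp 6 :=
      mul_le_mul hΔ (Real.exp_le_exp.2 h6) (Real.exp_pos _).le (by positivity)
    linarith

/-- **Lagarias–Montague 2011, Lemma 3.3 (2)** — the `XiPrimitive.lean` copy `LagariasMontague2011_lemma33_2`,
discharged: it is the same proposition as `LagariasMontague2011_lem_3_3_ii` (`LagariasMontague2011_lemma33_2_iff`
of `XiIntegralBridge.lean`, `Iff.rfl`). [cite: LagariasMontague2011, Lemma 3.3 (2)] -/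
theorem LagariasMontague2011_lemma33_2_holds : LagariasMontague2011_lemma33_2 :=
  LagariasMontague2011_lemma33_2_iff.2 LagariasMontague2011_lem_3_3_ii_holds

end Literature.NumberTheory.LFunctions
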